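import Literature.NumberTheory.Automorphic.HyperspecialUnitaryCompactOpen
import Literature.NumberTheory.Automorphic.UnitaryGroupIsotropicLineElements
import Literature.NumberTheory.Automorphic.SymplecticBorelUnipotentRadical
import Literature.NumberTheory.Automorphic.HermitianLatticesLocal
import HarnessLib

/-!
# The unitary group of an ANISOTROPIC hermitian form over a discretely valued field with compact valuation ring is COMPACT

Topic `NumberTheory/Automorphic`; namespace `Literature.NumberTheory.Automorphic.HermitianLattice` (the abstract `Valued K ℤᵐ⁰` setting of
★ `HyperspecialUnitaryCartanUnique` ∕ ★ `HyperspecialUnitaryCompactOpen`).  THEOREMS ONLY (kernel lane): no `def`, no named fact, no instance, no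
notation, no `sorry`.

Setting: `K` a field with a valuation `v : K → ℤᵐ⁰` (`Valued K ℤᵐ⁰`), an element `ϖ` with `v ϖ = exp (-1)` (a uniformiser), COMPACT valuation
ring `𝒪 = {v ≤ 1}` (e.g. `K` a non-archimedean local field, a completion `E_w` of a number field); `σ : K →+* K` a ring endomorphism
preserving `v` (`v (σ x) = v x`, e.g. the conjugation of an unramified or ramified quadratic extension `E_w ⊃ F_v`); `H ∈ M_n(K)` any matrix whose
hermitian pairing `h(x, y) = (σ x)ᵀ H y` (★ `UnitaryGroup.hermForm`) is ANISOTROPIC: `h(x, x) = 0 ⇒ x = 0`.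

* §1 balls of a discretely valued field: `{v ≤ exp k} = (ϖ^k · )⁻¹ 𝒪` (★ `SymplecticCartan.v_uniformizer_zpow_mul_le_one_iff`) is open, closed and
  compact (`isCompact_setOf_v_le_exp_int`); the unit sphere `{v = 1}` is closed (★ `v_lt_one_iff`).
* §2 **COERCIVITY of an anisotropic form** (`exists_forall_v_sq_le_v_hermForm_self`): there is `m : ℕ` with
  `v(x_i)² · exp(−m) ≤ v(h(x, x))` for all `x ∈ Kⁿ` and all `i` — on the compact «unit sphere» `S = {x : max v(x_i) = 1}` the continuous `h(x,x)` does
  not vanish, so `v(h(x,x)) ≥ exp(−m)` there (a directed open cover of the compact `S` by the sets `{v(h(x,x)) > exp(−m−1)}`), and every `x ≠ 0` is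
  `c · y` with `y ∈ S`, `c = x_{i₀}` a coordinate of maximal valuation, `h(x,x) = σ(c) c h(y,y)`.
* §3 **BOUNDEDNESS** (`exists_forall_v_apply_le_exp_of_mem_unitaryGroupOfForm`): the entries of every `g ∈ U(σ, H)` (and of `g⁻¹ ∈ U(σ, H)`) satisfy
  `v(g_{ij}) ≤ exp B` for one `B : ℕ` — the columns `g e_j` have `h(g e_j, g e_j) = h(e_j, e_j) = H_{jj}`, bounded, so coercivity bounds their
  coordinates.
* §4 **COMPACTNESS** (`isCompact_unitaryGroupOfForm_of_anisotropic`, `compactSpace_unitaryGroupOfForm_of_anisotropic`): `U(σ, H)` is a closed (★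
  `isClosed_unitaryGroupOfForm`) subset of the image in `GL_n(K)` of the compact set of pairs `(A, A′)` of matrices with bounded entries and
  `A A′ = 1 = A′ A`.

This is the classical fact «the unitary (orthogonal) group of an anisotropic form over a local field is compact» ([PlatonovRapinchuk1994, §3.1
Thm. 3.1 «`G_{K_v}` is compact iff `G` is `K_v`-anisotropic» — for the reductive group `U(h)` anisotropy of the group is anisotropy of `h`];
[WeilBNT1967, Ch. II §1–2: norms and compactness over local fields]; [Tits1979, §3.2]).  USE (cell hodgecm-mathlib, director s465 on the `N = 2`
edition of the engine of programme P5): at a finite place `v ∈ T` of `L⁺` where the hermitian PLANE `H ⊗ L⁺_v` is anisotropic, the local group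
`U(H)(L⁺_v) ≅ U(σ_w, H_w)(L_w)` (★ `UnitaryGroup.localNonsplitEquiv`) is COMPACT — the «`v ∈ S`» places of [Rogawski1990, §14.2 (i)–(iii)] where the
inner form is not quasi-split; there all irreducible representations are finite-dimensional and every locally constant function is a test function.
HC_CM is proved only modulo the printed citations until rung 0 closes.

## References
* [PlatonovRapinchuk1994] V. Platonov, A. Rapinchuk, *Algebraic Groups and Number Theory* (1994), §3.1 Thm. 3.1 (compactness ⟺ anisotropy over
  local fields), §2.3 (unitary groups of hermitian forms).
* [WeilBNT1967] A. Weil, *Basic Number Theory* (1967), Ch. I §4 (compactness of `𝒪`-modules), Ch. II §1–§2 (`K`-norms on vector spaces over local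
  fields; all norms define the product topology; compact balls).
* [Tits1979] J. Tits, *Reductive groups over local fields*, Corvallis PSPM 33.1 (1979), §3.2.
* [Rogawski1990] J. Rogawski, *Automorphic representations of unitary groups in three variables*, Ann. of Math. Stud. 123 (1990), §14.2 p. 232.
-/

noncomputable section

open scoped Valued WithZero Matrix MatrixGroups
open Matrix

namespace Literature.NumberTheory.Automorphic.HermitianLattice

open Literature.NumberTheory.Automorphic.SymplecticCartan
open Literature.NumberTheory.Automorphic.UnitaryGroup (hermForm hermForm_mulVec hermForm_smul_left_eq hermForm_single_single)

variable {K : Type*} [Field K] [Valued K ℤᵐ⁰] {ϖ : K}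

/-! ## §1 Balls and the unit sphere of a discretely valued field -/

/-- `{x | v x ≤ exp k}` is the preimage of the valuation ring under `x ↦ ϖ^k x`. [cite: WeilBNT1967, Ch. II §1] -/
theorem setOf_v_le_exp_eq_preimage (hϖ : Valued.v ϖ = WithZero.exp (-1 : ℤ)) (k : ℤ) :
    {x : K | Valued.v x ≤ WithZero.exp k} = (fun x => ϖ ^ k * x) ⁻¹' (𝒪[K] : Set K) := by
  ext x
  rw [Set.mem_setOf_eq, Set.mem_preimage, SetLike.mem_coe, Valuation.mem_integer_iff,
    v_uniformizer_zpow_mul_le_one_iff hϖ]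

/-- `{x | v x ≤ exp k}` is the image of the valuation ring under `x ↦ ϖ^(-k) x`. [cite: WeilBNT1967, Ch. II §1] -/
theorem setOf_v_le_exp_eq_image (hϖ : Valued.v ϖ = WithZero.exp (-1 : ℤ)) (k : ℤ) :
    {x : K | Valued.v x ≤ WithZero.exp k} = (fun x => ϖ ^ (-k) * x) '' (𝒪[K] : Set K) := by
  have hϖ0 : ϖ ≠ 0 := by
    intro h
    rw [h, map_zero] at hϖ
    exact WithZero.zero_ne_coe hϖ
  rw [setOf_v_le_exp_eq_preimage hϖ k]
  ext x
  constructor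
  · intro hx
    refine ⟨ϖ ^ k * x, hx, ?_⟩
    change ϖ ^ (-k) * (ϖ ^ k * x) = x
    rw [← mul_assoc, ← zpow_add₀ hϖ0, neg_add_cancel, zpow_zero, one_mul]
  · rintro ⟨y, hy, rfl⟩
    change ϖ ^ k * (ϖ ^ (-k) * y) ∈ (𝒪[K] : Set K)
    rwa [← mul_assoc, ← zpow_add₀ hϖ0, add_neg_cancel, zpow_zero, one_mul]

/-- The balls `{v ≤ exp k}` (`k : ℤ`) are OPEN. [cite: WeilBNT1967, Ch. II §1] -/
theorem isOpen_setOf_v_le_exp_int (hϖ : Valued.v ϖ = WithZero.exp (-1 : ℤ)) (k : ℤ) :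
    IsOpen {x : K | Valued.v x ≤ WithZero.exp k} := by
  rw [setOf_v_le_exp_eq_preimage hϖ k]
  exact (Valued.isOpen_integer K).preimage (continuous_const.mul continuous_id)

/-- The balls `{v ≤ exp k}` (`k : ℤ`) are CLOSED. [cite: WeilBNT1967, Ch. II §1] -/
theorem isClosed_setOf_v_le_exp_int (hϖ : Valued.v ϖ = WithZero.exp (-1 : ℤ)) (k : ℤ) :
    IsClosed {x : K | Valued.v x ≤ WithZero.exp k} := by
  rw [setOf_v_le_exp_eq_preimage hϖ k]
  exact (Valued.isClosed_integer K).preimage (continuous_const.mul continuous_id)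

/-- The valuation ring is compact as a subset of `K` when `𝒪` is a compact space. [cite: WeilBNT1967, Ch. I §4] -/
theorem isCompact_integer [CompactSpace 𝒪[K]] : IsCompact (𝒪[K] : Set K) :=
  isCompact_iff_compactSpace.2 (inferInstanceAs (CompactSpace 𝒪[K]))

/-- The balls `{v ≤ exp k}` (`k : ℤ`) are COMPACT when `𝒪` is compact. [cite: WeilBNT1967, Ch. II §1 Cor. 1 p. 28] -/
theorem isCompact_setOf_v_le_exp_int [CompactSpace 𝒪[K]] (hϖ : Valued.v ϖ = WithZero.exp (-1 : ℤ)) (k : ℤ) :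
    IsCompact {x : K | Valued.v x ≤ WithZero.exp k} := by
  rw [setOf_v_le_exp_eq_image hϖ k]
  exact isCompact_integer.image (continuous_const.mul continuous_id)

/-- The unit sphere `{v = 1}` is CLOSED. [cite: WeilBNT1967, Ch. II §1] -/
theorem isClosed_setOf_v_eq_one (hϖ : Valued.v ϖ = WithZero.exp (-1 : ℤ)) : IsClosed {x : K | Valued.v x = 1} := by
  have h : {x : K | Valued.v x = 1} = {x : K | Valued.v x ≤ WithZero.exp (0 : ℤ)} ∩ {x : K | Valued.v x ≤ WithZero.exp (-1 : ℤ)}ᶜ := by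
    ext x
    simp only [Set.mem_inter_iff, Set.mem_setOf_eq, Set.mem_compl_iff, WithZero.exp_zero, ← v_lt_one_iff, not_lt]
    exact ⟨fun h => ⟨h.le, h.ge⟩, fun h => le_antisymm h.1 h.2⟩
  rw [h]
  exact (isClosed_setOf_v_le_exp_int hϖ 0).inter (isOpen_setOf_v_le_exp_int hϖ (-1)).isClosed_compl

/-! ## §2 Coercivity of an anisotropic hermitian form -/

section Form

variable {n : Type*} [Fintype n] [DecidableEq n] {σ : K →+* K} {H : Matrix n n K}

omit [Valued K ℤᵐ⁰] [DecidableEq n] in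
/-- `h(x, c • y) = c · h(x, y)` (linearity of the hermitian pairing in the second variable). [cite: MoeglinVignerasWaldspurger1987, Chap. 1 I.17] -/
theorem hermForm_smul_right (σ : K →+* K) (H : Matrix n n K) (c : K) (x y : n → K) :
    hermForm σ H x (c • y) = c * hermForm σ H x y := by
  rw [Literature.NumberTheory.Automorphic.UnitaryGroup.hermForm_apply, Literature.NumberTheory.Automorphic.UnitaryGroup.hermForm_apply,
    Matrix.mulVec_smul, dotProduct_smul, smul_eq_mul]

omit [DecidableEq n] in
/-- `h(x, x)` is continuous in `x` for continuous `σ` (a polynomial in the coordinates and their conjugates). [cite: WeilBNT1967, Ch. II §2] -/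
theorem continuous_hermForm_self (hσ : Continuous σ) (H : Matrix n n K) : Continuous fun x : n → K => hermForm σ H x x := by
  have h1 : Continuous fun x : n → K => (⇑σ ∘ x) := continuous_pi fun i => hσ.comp (continuous_apply i)
  have h2 : Continuous fun x : n → K => H *ᵥ x := Continuous.matrix_mulVec continuous_const continuous_id
  exact h1.dotProduct h2

omit [DecidableEq n] in
/-- The «unit sphere» `S = {x : (∀ i, v x_i ≤ 1) ∧ ∃ i, v x_i = 1}` of `Kⁿ` is compact when `𝒪` is. [cite: WeilBNT1967, Ch. II §1] -/
theorem isCompact_unitSphere [CompactSpace 𝒪[K]] (hϖ : Valued.v ϖ = WithZero.exp (-1 : ℤ)) :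
    IsCompact {x : n → K | (∀ i, Valued.v (x i) ≤ 1) ∧ ∃ i, Valued.v (x i) = 1} := by
  have hbox : IsCompact (Set.pi Set.univ fun _ : n => (𝒪[K] : Set K)) := isCompact_univ_pi fun _ => isCompact_integer
  refine hbox.of_isClosed_subset ?_ ?_
  · have h1 : IsClosed {x : n → K | ∀ i, Valued.v (x i) ≤ 1} := by
      have : {x : n → K | ∀ i, Valued.v (x i) ≤ 1} = ⋂ i, (fun x : n → K => x i) ⁻¹' (𝒪[K] : Set K) := by
        ext x; simp [Valuation.mem_integer_iff]
      rw [this]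
      exact isClosed_iInter fun i => (Valued.isClosed_integer K).preimage (continuous_apply i)
    have h2 : IsClosed {x : n → K | ∃ i, Valued.v (x i) = 1} := by
      have : {x : n → K | ∃ i, Valued.v (x i) = 1} = ⋃ i, (fun x : n → K => x i) ⁻¹' {y : K | Valued.v y = 1} := by
        ext x; simp
      rw [this]
      exact isClosed_iUnion_of_finite fun i => (isClosed_setOf_v_eq_one hϖ).preimage (continuous_apply i)
    simpa only [Set.setOf_and] using h1.inter h2
  · intro x hx
    exact Set.mem_univ_pi.2 fun i => (Valuation.mem_integer_iff _ _).2 (hx.1 i)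

omit [DecidableEq n] in
/-- **Coercivity on the unit sphere**: for `σ` preserving `v`, `𝒪` compact and `h` anisotropic there is `m : ℕ` with `exp (-m) ≤ v(h(x, x))` for every
`x` in the unit sphere. [cite: PlatonovRapinchuk1994, §3.1 Thm. 3.1] [cite: WeilBNT1967, Ch. II §1 Prop. 2] -/
theorem exists_forall_exp_neg_le_v_hermForm_self_of_mem_unitSphere [CompactSpace 𝒪[K]] (hϖ : Valued.v ϖ = WithZero.exp (-1 : ℤ))
    (hσ : ∀ x, Valued.v (σ x) = Valued.v x) (hanis : ∀ x : n → K, hermForm σ H x x = 0 → x = 0) :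
    ∃ m : ℕ, ∀ x : n → K, ((∀ i, Valued.v (x i) ≤ 1) ∧ ∃ i, Valued.v (x i) = 1) →
      WithZero.exp (-(m : ℤ)) ≤ Valued.v (hermForm σ H x x) := by
  have hq : Continuous fun x : n → K => hermForm σ H x x := continuous_hermForm_self (continuous_of_forall_v_eq hσ) H
  let U : ℕ → Set (n → K) := fun m => {x | ¬ Valued.v (hermForm σ H x x) ≤ WithZero.exp (-(m : ℤ) - 1)}
  have hUo : ∀ m, IsOpen (U m) := fun m =>
    ((isClosed_setOf_v_le_exp_int hϖ (-(m : ℤ) - 1)).preimage hq).isOpen_compl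
  have hmono : Monotone U := by
    intro m m' hmm' x hx hx'
    exact hx (hx'.trans (WithZero.exp_le_exp.2 (by omega)))
  have hcover : {x : n → K | (∀ i, Valued.v (x i) ≤ 1) ∧ ∃ i, Valued.v (x i) = 1} ⊆ ⋃ m, U m := by
    rintro x ⟨-, i, hi⟩
    have hx0 : hermForm σ H x x ≠ 0 := by
      intro h0
      have := congr_fun (hanis x h0) i
      rw [Pi.zero_apply] at this
      rw [this, map_zero] at hi
      exact zero_ne_one hi
    have hne : Valued.v (hermForm σ H x x) ≠ 0 := (Valuation.ne_zero_iff _).2 hx0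
    set k : ℤ := WithZero.log (Valued.v (hermForm σ H x x)) with hk_def
    have hk : Valued.v (hermForm σ H x x) = WithZero.exp k := (WithZero.exp_log hne).symm
    refine Set.mem_iUnion.2 ⟨(-k).toNat, ?_⟩
    change ¬ _ ≤ _
    rw [hk, WithZero.exp_le_exp, not_le]
    have := Int.self_le_toNat (-k)
    omega
  obtain ⟨m, hm⟩ := (isCompact_unitSphere (n := n) hϖ).elim_directed_cover U hUo hcover (Monotone.directed_le hmono)
  refine ⟨m, fun x hx => ?_⟩
  have hxU : ¬ Valued.v (hermForm σ H x x) ≤ WithZero.exp (-(m : ℤ) - 1) := hm hx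
  have hx0 : Valued.v (hermForm σ H x x) ≠ 0 := by
    intro h0
    rw [h0] at hxU
    exact hxU zero_le
  rw [← WithZero.exp_log hx0, WithZero.exp_le_exp] at hxU ⊢
  omega

/-- **COERCIVITY of an anisotropic hermitian form**: `v(x_i)² · exp(−m) ≤ v(h(x, x))` for all `x ∈ Kⁿ`, all `i`, with one `m : ℕ` (`σ` preserving
`v`, `𝒪` compact).  Every `x ≠ 0` is `c · y` with `y` on the unit sphere and `c` a coordinate of maximal valuation; `h(c y, c y) = σ(c) c h(y, y)`.
[cite: PlatonovRapinchuk1994, §3.1 Thm. 3.1] [cite: WeilBNT1967, Ch. II §1 Prop. 2] -/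
theorem exists_forall_v_sq_le_v_hermForm_self [CompactSpace 𝒪[K]] (hϖ : Valued.v ϖ = WithZero.exp (-1 : ℤ))
    (hσ : ∀ x, Valued.v (σ x) = Valued.v x) (hanis : ∀ x : n → K, hermForm σ H x x = 0 → x = 0) :
    ∃ m : ℕ, ∀ (x : n → K) (i : n), Valued.v (x i) * Valued.v (x i) * WithZero.exp (-(m : ℤ)) ≤ Valued.v (hermForm σ H x x) := by
  obtain ⟨m, hm⟩ := exists_forall_exp_neg_le_v_hermForm_self_of_mem_unitSphere hϖ hσ hanis
  refine ⟨m, fun x i => ?_⟩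
  by_cases hx : x = 0
  · subst hx
    rw [Pi.zero_apply, map_zero, zero_mul, zero_mul]
    exact zero_le
  -- a coordinate of maximal valuation
  have hne : (Finset.univ : Finset n).Nonempty := by
    obtain ⟨j, -⟩ := Function.ne_iff.1 hx
    exact ⟨j, Finset.mem_univ j⟩
  obtain ⟨i₀, -, hi₀⟩ := Finset.exists_max_image Finset.univ (fun j => Valued.v (x j)) hne
  set c := x i₀ with hc
  have hc0 : c ≠ 0 := by
    intro h0
    obtain ⟨j, hj⟩ := Function.ne_iff.1 hx
    have hle : Valued.v (x j) ≤ Valued.v c := hi₀ j (Finset.mem_univ j)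
    rw [h0, map_zero, le_zero_iff, Valuation.zero_iff] at hle
    exact hj hle
  have hvc0 : Valued.v c ≠ 0 := (Valuation.ne_zero_iff _).2 hc0
  -- the rescaled vector lies on the unit sphere
  set y : n → K := c⁻¹ • x with hy
  have hyS : (∀ j, Valued.v (y j) ≤ 1) ∧ ∃ j, Valued.v (y j) = 1 := by
    refine ⟨fun j => ?_, ⟨i₀, ?_⟩⟩
    · rw [hy, Pi.smul_apply, smul_eq_mul, map_mul, map_inv₀]
      calc (Valued.v c)⁻¹ * Valued.v (x j) ≤ (Valued.v c)⁻¹ * Valued.v c := mul_le_mul' le_rfl (hi₀ j (Finset.mem_univ j))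
        _ = 1 := inv_mul_cancel₀ hvc0
    · rw [hy, Pi.smul_apply, smul_eq_mul, map_mul, map_inv₀, ← hc, inv_mul_cancel₀ hvc0]
  have hmy := hm y hyS
  -- `h(y, y) = σ(c⁻¹) c⁻¹ h(x, x)`
  have hqy : hermForm σ H y y = σ c⁻¹ * (c⁻¹ * hermForm σ H x x) := by
    rw [hy, hermForm_smul_left_eq, hermForm_smul_right]
  rw [hqy, map_mul, map_mul, hσ, map_inv₀] at hmy
  -- multiply by `v(c)²`
  have key : Valued.v c * Valued.v c * WithZero.exp (-(m : ℤ)) ≤ Valued.v (hermForm σ H x x) := by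
    calc Valued.v c * Valued.v c * WithZero.exp (-(m : ℤ))
        ≤ Valued.v c * Valued.v c * ((Valued.v c)⁻¹ * ((Valued.v c)⁻¹ * Valued.v (hermForm σ H x x))) := mul_le_mul' le_rfl hmy
      _ = Valued.v (hermForm σ H x x) := by
          rw [← mul_assoc, mul_assoc (Valued.v c) (Valued.v c), mul_inv_cancel₀ hvc0, mul_one, mul_inv_cancel_left₀ hvc0]
  have hxi : Valued.v (x i) ≤ Valued.v c := hi₀ i (Finset.mem_univ i)
  exact (mul_le_mul' (mul_le_mul' hxi hxi) le_rfl).trans key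

/-! ## §3 Boundedness of `U(σ, H)` -/

/-- **The entries of an element of the unitary group of an anisotropic form are bounded**: `v(g_{ij}) ≤ exp B` for one `B : ℕ`, for every
`g ∈ U(σ, H)` (hence also for `g⁻¹`). [cite: PlatonovRapinchuk1994, §3.1 Thm. 3.1] -/
theorem exists_forall_v_apply_le_exp_of_mem_unitaryGroupOfForm [CompactSpace 𝒪[K]] (hϖ : Valued.v ϖ = WithZero.exp (-1 : ℤ))
    (hσ : ∀ x, Valued.v (σ x) = Valued.v x) (hanis : ∀ x : n → K, hermForm σ H x x = 0 → x = 0) :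
    ∃ B : ℕ, ∀ g ∈ unitaryGroupOfForm σ H, ∀ i j, Valued.v ((g : Matrix n n K) i j) ≤ WithZero.exp (B : ℤ) := by
  obtain ⟨m, hm⟩ := exists_forall_v_sq_le_v_hermForm_self hϖ hσ hanis
  -- the diagonal entries of `H` are bounded
  obtain ⟨M, hM⟩ := exists_forall_v_le_exp_of_isCompact hϖ (Set.finite_range fun j : n => H j j).isCompact
  refine ⟨M + m, fun g hg i j => ?_⟩
  -- the `j`-th column of `g` and its length
  have hcol : (g : Matrix n n K) *ᵥ Pi.single j 1 = fun i => (g : Matrix n n K) i j := by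
    ext i'
    simp [Matrix.mulVec, dotProduct, Pi.single_apply]
  have hlen : hermForm σ H (fun i => (g : Matrix n n K) i j) (fun i => (g : Matrix n n K) i j) = H j j := by
    rw [← hcol, hermForm_mulVec σ (mem_unitaryGroupOfForm_iff.1 hg), hermForm_single_single]
  have h1 := hm (fun i => (g : Matrix n n K) i j) i
  rw [hlen] at h1
  have h2 : Valued.v (H j j) ≤ WithZero.exp (M : ℤ) := hM _ ⟨j, rfl⟩
  have h3 := h1.trans h2
  by_cases h0 : Valued.v ((g : Matrix n n K) i j) = 0
  · rw [h0]; exact zero_le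
  · rw [← WithZero.exp_log h0] at h3 ⊢
    rw [← WithZero.exp_add, ← WithZero.exp_add, WithZero.exp_le_exp] at h3
    rw [WithZero.exp_le_exp]
    push_cast
    omega

/-! ## §4 Compactness of `U(σ, H)` -/

omit [Valued K ℤᵐ⁰] in
/-- The map `(A, A′) ↦ A` from the pairs of mutually inverse matrices to `GL_n(K)` is continuous (units topology). [folklore] -/
private theorem continuous_unitsOfPair [TopologicalSpace K] [IsTopologicalRing K] :
    Continuous fun p : ↥({p : Matrix n n K × Matrix n n K | p.1 * p.2 = 1 ∧ p.2 * p.1 = 1} : Set (Matrix n n K × Matrix n n K)) =>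
      (⟨p.1.1, p.1.2, p.2.1, p.2.2⟩ : GL n K) := by
  refine Units.continuous_iff.2 ⟨?_, ?_⟩
  · exact continuous_fst.comp continuous_subtype_val
  · exact continuous_snd.comp continuous_subtype_val

/-- The set of `g ∈ GL_n(K)` with `v(g_{ij}) ≤ exp B` and `v((g⁻¹)_{ij}) ≤ exp B` is compact (`𝒪` compact): the continuous image of the compact set of
pairs `(A, A′)` of bounded matrices with `A A′ = 1 = A′ A`. [cite: WeilBNT1967, Ch. II §2] -/
theorem isCompact_setOf_v_apply_le_exp [CompactSpace 𝒪[K]] (hϖ : Valued.v ϖ = WithZero.exp (-1 : ℤ)) (B : ℕ) :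
    IsCompact {g : GL n K | (∀ i j, Valued.v ((g : Matrix n n K) i j) ≤ WithZero.exp (B : ℤ)) ∧
      ∀ i j, Valued.v (((g⁻¹ : GL n K) : Matrix n n K) i j) ≤ WithZero.exp (B : ℤ)} := by
  -- the compact box of bounded matrices
  let ball : Set K := {x : K | Valued.v x ≤ WithZero.exp (B : ℤ)}
  have hball : IsCompact ball := isCompact_setOf_v_le_exp_int hϖ B
  let Box : Set (Matrix n n K) := Set.pi Set.univ fun _ : n => Set.pi Set.univ fun _ : n => ball
  have hBox : IsCompact Box := by exact isCompact_univ_pi fun _ => isCompact_univ_pi fun _ => hball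
  have memBox : ∀ A : Matrix n n K, A ∈ Box ↔ ∀ i j, Valued.v (A i j) ≤ WithZero.exp (B : ℤ) := fun A =>
    ⟨fun h i j => Set.mem_univ_pi.1 (Set.mem_univ_pi.1 h i) j, fun h => Set.mem_univ_pi.2 fun i => Set.mem_univ_pi.2 fun j => h i j⟩
  -- the closed set of mutually inverse pairs and its compact bounded part
  let Sinv : Set (Matrix n n K × Matrix n n K) := {p | p.1 * p.2 = 1 ∧ p.2 * p.1 = 1}
  have hSinv : IsClosed Sinv :=
    (isClosed_eq (continuous_fst.mul continuous_snd) continuous_const).inter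
      (isClosed_eq (continuous_snd.mul continuous_fst) continuous_const)
  let C : Set (Matrix n n K × Matrix n n K) := Sinv ∩ Box ×ˢ Box
  have hC : IsCompact C := (hBox.prod hBox).of_isClosed_subset (hSinv.inter ((hBox.isClosed).prod hBox.isClosed)) Set.inter_subset_right
  -- its image in `GL_n(K)`
  let f : ↥Sinv → GL n K := fun p => ⟨p.1.1, p.1.2, p.2.1, p.2.2⟩
  have hf : Continuous f := continuous_unitsOfPair
  have hC' : IsCompact (Subtype.val ⁻¹' C : Set ↥Sinv) := hSinv.isClosedEmbedding_subtypeVal.isCompact_preimage hC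
  refine (hC'.image hf).of_isClosed_subset ?_ ?_
  · -- the target set is closed in `GL_n(K)`
    have hval : Continuous fun g : GL n K => (g : Matrix n n K) := Units.continuous_val
    have hinv : Continuous fun g : GL n K => ((g⁻¹ : GL n K) : Matrix n n K) := Units.continuous_coe_inv
    have hcl : IsClosed {x : K | Valued.v x ≤ WithZero.exp (B : ℤ)} := isClosed_setOf_v_le_exp_int hϖ B
    have h1 : IsClosed {g : GL n K | ∀ i j, Valued.v ((g : Matrix n n K) i j) ≤ WithZero.exp (B : ℤ)} := by
      have : {g : GL n K | ∀ i j, Valued.v ((g : Matrix n n K) i j) ≤ WithZero.exp (B : ℤ)} =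
          ⋂ i, ⋂ j, (fun g : GL n K => (g : Matrix n n K) i j) ⁻¹' {x : K | Valued.v x ≤ WithZero.exp (B : ℤ)} := by
        ext g; simp
      rw [this]
      exact isClosed_iInter fun i => isClosed_iInter fun j => hcl.preimage (hval.matrix_elem i j)
    have h2 : IsClosed {g : GL n K | ∀ i j, Valued.v (((g⁻¹ : GL n K) : Matrix n n K) i j) ≤ WithZero.exp (B : ℤ)} := by
      have : {g : GL n K | ∀ i j, Valued.v (((g⁻¹ : GL n K) : Matrix n n K) i j) ≤ WithZero.exp (B : ℤ)} =
          ⋂ i, ⋂ j, (fun g : GL n K => ((g⁻¹ : GL n K) : Matrix n n K) i j) ⁻¹' {x : K | Valued.v x ≤ WithZero.exp (B : ℤ)} := by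
        ext g; simp
      rw [this]
      exact isClosed_iInter fun i => isClosed_iInter fun j => hcl.preimage (hinv.matrix_elem i j)
    simpa only [Set.setOf_and] using h1.inter h2
  · rintro g ⟨hg, hg'⟩
    refine ⟨⟨((g : Matrix n n K), ((g⁻¹ : GL n K) : Matrix n n K)), ?_⟩, ?_, ?_⟩
    · exact ⟨by rw [← Units.val_mul, mul_inv_cancel, Units.val_one], by rw [← Units.val_mul, inv_mul_cancel, Units.val_one]⟩
    · exact ⟨⟨by rw [← Units.val_mul, mul_inv_cancel, Units.val_one], by rw [← Units.val_mul, inv_mul_cancel, Units.val_one]⟩,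
        (memBox _).2 hg, (memBox _).2 hg'⟩
    · exact Units.ext rfl

/-- **The unitary group of an anisotropic hermitian form over a discretely valued field with compact valuation ring is COMPACT** (as a subset of
`GL_n(K)`): `σ` preserving `v`, `v ϖ = exp(-1)`, `𝒪` compact, `h(x,x) = 0 ⇒ x = 0`.  It is closed (★ `isClosed_unitaryGroupOfForm`) inside the compact
set of `g` with `g`, `g⁻¹` bounded (`exists_forall_v_apply_le_exp_of_mem_unitaryGroupOfForm`, `isCompact_setOf_v_apply_le_exp`).
[cite: PlatonovRapinchuk1994, §3.1 Thm. 3.1] [cite: Tits1979, §3.2] -/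
theorem isCompact_unitaryGroupOfForm_of_anisotropic [CompactSpace 𝒪[K]] (hϖ : Valued.v ϖ = WithZero.exp (-1 : ℤ))
    (hσ : ∀ x, Valued.v (σ x) = Valued.v x) (hanis : ∀ x : n → K, hermForm σ H x x = 0 → x = 0) :
    IsCompact ((unitaryGroupOfForm σ H : Subgroup (GL n K)) : Set (GL n K)) := by
  obtain ⟨B, hB⟩ := exists_forall_v_apply_le_exp_of_mem_unitaryGroupOfForm hϖ hσ hanis
  refine (isCompact_setOf_v_apply_le_exp (n := n) hϖ B).of_isClosed_subset
    (isClosed_unitaryGroupOfForm (continuous_of_forall_v_eq hσ) H) fun g hg => ⟨hB g hg, hB g⁻¹ (Subgroup.inv_mem _ hg)⟩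

/-- **`U(σ, H)` is a compact space** for `H` anisotropic (same hypotheses). [cite: PlatonovRapinchuk1994, §3.1 Thm. 3.1] [cite: Tits1979, §3.2] -/
theorem compactSpace_unitaryGroupOfForm_of_anisotropic [CompactSpace 𝒪[K]] (hϖ : Valued.v ϖ = WithZero.exp (-1 : ℤ))
    (hσ : ∀ x, Valued.v (σ x) = Valued.v x) (hanis : ∀ x : n → K, hermForm σ H x x = 0 → x = 0) :
    CompactSpace (unitaryGroupOfForm σ H) :=
  isCompact_iff_compactSpace.1 (isCompact_unitaryGroupOfForm_of_anisotropic hϖ hσ hanis)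

/-- **Every closed subgroup of `U(σ, H)` — in particular every subgroup isomorphic (as a topological group) to it — is compact**; recorded in the
form consumed through ★ `UnitaryGroup.localNonsplitEquiv`: a topological group `G` admitting a `ContinuousMulEquiv` onto `U(σ, H)` is a compact space.
[cite: PlatonovRapinchuk1994, §3.1 Thm. 3.1] -/
theorem compactSpace_of_continuousMulEquiv_unitaryGroupOfForm [CompactSpace 𝒪[K]] (hϖ : Valued.v ϖ = WithZero.exp (-1 : ℤ))
    (hσ : ∀ x, Valued.v (σ x) = Valued.v x) (hanis : ∀ x : n → K, hermForm σ H x x = 0 → x = 0)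
    {G : Type*} [Group G] [TopologicalSpace G] (e : G ≃ₜ* unitaryGroupOfForm σ H) : CompactSpace G :=
  haveI := compactSpace_unitaryGroupOfForm_of_anisotropic hϖ hσ hanis
  e.symm.toHomeomorph.compactSpace

end Form

end Literature.NumberTheory.Automorphic.HermitianLattice

end
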